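import Literature.AnabelianGeometry.EtaleTheta.Discharge.Sec2TowerLemmas

/-!
# [EtTh] §2: the calculus of `RigidData.Induces` and `RigidData.MuConj` — proof-only companion
# of `ThetaRigidity.lean` (Prop 2.11 (ii), Prop 2.14 (iii), Cor 2.18 (iii)–(iv), Cor 2.19 (i))

Mochizuki, *The Étale Theta Function and its Frobenioid-theoretic Manifestations* [EtTh],
Publ. RIMS 45 (2009), §2, PRIMS PDF pp.44, 49–50, 61–64 (bib key `MochizukiEtTh2009`).
PROOF-ONLY (no `def`, no new named fact, no instance; nothing of `ThetaRigidity.lean`, seat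
abc-iut-L2-t2, is edited or restated); cell `abc-iut`, seat abc-iut-f-148 (F-TRANCHES 148), for
the FROZEN FACT-LIST rows F-0628 `RigidData.Induces` and F-0629 `RigidData.MuConj`. Both are
PREDICATES (vocabulary of `Prop214_iii_*`, `Cor218_iv_*`, `Cor219_i_*`; universal closures
refuted at a toy in `ThetaRigiditySchemaWitness.lean`, abc-iut-w5-d175); what such a row can
carry in the kernel is its CALCULUS and the MECHANISM print attaches to it, proved here over an
arbitrary `R : RigidData N l`:

* §1 `Induces` is functional and multiplicative (`Induces.unique/mul/inv`, `induces_one`); an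
  inducing `α` preserves the cyclotome `μ_N = Ker(Π^tp_Y[μ_N] ↠ Π^tp_Y)`
  (`Induces.map_ker_proj`); `μ_N`-conjugations and Kummer shifts induce the identity.
* §2 EXISTENCE — the docstring sentence "(Prop 2.11 (ii): every `α` induces one)" of `Induces`,
  i.e. the first clause of Prop 2.14 (iii) "every automorphism of `M` induces an automorphism
  of `Π^tp_Y`" (p.49), through Cor 2.18 (iii) "the quotient `Π• ↠ Π•_Y` may be reconstructed
  group-theoretically" (p.61): `exists_induces_of_inMu_into` (a bi-continuous `α` with
  `α(μ_N) ⊆ μ_N` induces the bi-continuous `ᾱ = proj ∘ α ∘ s^alg`; `μ_N` is finite, so `⊆` is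
  `=`), `exists_induces_of_map_ker`, **`exists_induces_of_cor218_iii_quotient :
  R.Cor218_iii_quotient → α ∈ Aut_top(Π^tp_Y[μ_N]) → ∃ a, R.Induces α a`** (FACT-LIST F-0623
  consumed BY NAME; `∃!` in `existsUnique_…`), `exists_induces_iso` (every automorphism of a
  model mono-theta environment).
* §3 `MuConj` is an equivalence relation (`muConj_equivalence`), explicit
  (`muConj_iff_exists_conj`), a congruence (`MuConj.mul_right`, `MuConj.mul_left_of_induces`),
  does not change the induced automorphism (`MuConj.induces_iff`), and `μ_N`-conjugate
  bi-continuous automorphisms have the SAME class in `Out(Π^tp_Y[μ_N])` (`MuConj.topOut_mk_eq`: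
  the superscript `μ` of Cor 2.18 (iv) is invisible in `D_Y`).
* §4 Transfer along `Induces` (reading of F-0627 `Cor219_i_subquotients`, clauses 2–3): for an
  inducing pair `(α, a)`, `α(H·μ_N) = H·μ_N` iff `a(H) = H` (`Induces.map_comap_proj_eq_iff`);
  so `α(Δ^tp_Y[μ_N]) = Δ^tp_Y[μ_N]` iff `a(Δ^tp_Y) = Δ^tp_Y`, and
  `α(μ_N·s^alg(l·Δ_Θ)) = μ_N·s^alg(l·Δ_Θ)` iff `a(l·Δ_Θ) = l·Δ_Θ`: these clauses ARE Cor 2.18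
  (i)-type invariances of the induced `ᾱ`.

HONEST FRAMING: pure group theory / topology of the cyclotomic envelope; nothing here asserts a
disputed claim, takes a side on [IUTchIII] Cor 3.12, or moves a FACT-LIST label. [EtTh] is
refereed; typed ≠ proved.
-/

namespace Literature.AnabelianGeometry.EtaleTheta

universe u

namespace RigidData

variable {N : ℕ+} {l : ℕ} (R : RigidData.{u} N l)

/-! ## §1. `Induces` is functional and multiplicative (row F-0628) -/

/-- `proj ∘ s^alg = id` pointwise. [cite: MochizukiEtTh2009, Def 2.10 p.44] -/
theorem proj_algSection (y : R.PiY) :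
    CycEnvelope.proj R.augY R.chi (CycEnvelope.algSection R.augY R.chi y) = y := rfl

/-- `proj` kills the cyclotome. [cite: MochizukiEtTh2009, Def 2.10 p.44] -/
theorem proj_inMu (c : R.mu) :
    CycEnvelope.proj R.augY R.chi (CycEnvelope.inMu R.augY R.chi c) = 1 :=
  SemidirectProduct.rightHom_inl c

variable {R}

/-- **The induced automorphism is unique**: `Induces α a` determines `a` (the projection
`Π^tp_Y[μ_N] ↠ Π^tp_Y` is onto). [cite: MochizukiEtTh2009, Prop 2.14(iii) p.49] -/
theorem Induces.unique {α : MulAut R.env} {a a' : R.PiY ≃ₜ* R.PiY} (h : R.Induces α a)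
    (h' : R.Induces α a') : a = a' := by
  refine ContinuousMulEquiv.ext fun y => ?_
  have h1 := h (CycEnvelope.algSection R.augY R.chi y)
  have h2 := h' (CycEnvelope.algSection R.augY R.chi y)
  rw [proj_algSection] at h1 h2
  rw [← h1, ← h2]

variable (R) in
/-- The identity induces the identity. [cite: MochizukiEtTh2009, Prop 2.14(iii) p.49] -/
theorem induces_one : R.Induces 1 (ContinuousMulEquiv.refl R.PiY) := fun _ => rfl

/-- **`Induces` is multiplicative**: if `α` induces `a` and `β` induces `b`, then `α ∘ β` induces
`a ∘ b`. [cite: MochizukiEtTh2009, Prop 2.14(iii) p.49] -/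
theorem Induces.mul {α β : MulAut R.env} {a b : R.PiY ≃ₜ* R.PiY} (hα : R.Induces α a)
    (hβ : R.Induces β b) : R.Induces (α * β) (b.trans a) := fun x => by
  rw [MulAut.mul_apply, ContinuousMulEquiv.trans_apply, hα, hβ]

/-- **`Induces` passes to inverses**: if `α` induces `a`, then `α⁻¹` induces `a⁻¹`.
[cite: MochizukiEtTh2009, Prop 2.14(iii) p.49] -/
theorem Induces.inv {α : MulAut R.env} {a : R.PiY ≃ₜ* R.PiY} (hα : R.Induces α a) :
    R.Induces α⁻¹ a.symm := fun x => by
  rw [ContinuousMulEquiv.eq_symm_apply, ← hα, MulAut.apply_inv_self]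

/-- An inducing automorphism maps the cyclotome into itself.
[cite: MochizukiEtTh2009, Prop 2.11(ii) p.44] -/
theorem Induces.proj_eq_one {α : MulAut R.env} {a : R.PiY ≃ₜ* R.PiY} (hα : R.Induces α a)
    {x : R.env} (hx : CycEnvelope.proj R.augY R.chi x = 1) :
    CycEnvelope.proj R.augY R.chi (α x) = 1 := by
  rw [hα, hx, map_one]

/-- An element over `1 ∈ Π^tp_Y` is in the cyclotome: `x = ι(x.left)`.
[cite: MochizukiEtTh2009, Def 2.10 p.44] -/
theorem eq_inMu_left_of_proj_eq_one {x : R.env} (hx : CycEnvelope.proj R.augY R.chi x = 1) :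
    x = CycEnvelope.inMu R.augY R.chi x.left := by
  have hx' : x.right = 1 := hx
  ext
  · simp
  · simp [hx']

/-- An inducing automorphism restricts to the cyclotome: `α(ι c) = ι c'`.
[cite: MochizukiEtTh2009, Prop 2.11(ii) p.44] -/
theorem Induces.exists_inMu_eq {α : MulAut R.env} {a : R.PiY ≃ₜ* R.PiY} (hα : R.Induces α a)
    (c : R.mu) :
    ∃ c' : R.mu, α (CycEnvelope.inMu R.augY R.chi c) = CycEnvelope.inMu R.augY R.chi c' :=
  ⟨_, eq_inMu_left_of_proj_eq_one (hα.proj_eq_one (R.proj_inMu c))⟩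

/-- An inducing automorphism maps `Ker(Π^tp_Y[μ_N] ↠ Π^tp_Y)` ONTO itself.
[cite: MochizukiEtTh2009, Prop 2.11(ii) p.44] -/
theorem Induces.map_ker_proj {α : MulAut R.env} {a : R.PiY ≃ₜ* R.PiY} (hα : R.Induces α a) :
    ((CycEnvelope.proj R.augY R.chi).ker).map α.toMonoidHom =
      (CycEnvelope.proj R.augY R.chi).ker := by
  ext x
  simp only [Subgroup.mem_map, MonoidHom.mem_ker, MulEquiv.coe_toMonoidHom]
  constructor
  · rintro ⟨y, hy, rfl⟩
    exact hα.proj_eq_one hy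
  · intro hx
    exact ⟨α⁻¹ x, hα.inv.proj_eq_one hx, MulAut.apply_inv_self _ α x⟩

variable (R) in
/-- **`μ_N`-conjugation induces the identity** on `Π^tp_Y`.
[cite: MochizukiEtTh2009, Cor 2.18(iv) p.61] -/
theorem induces_conj_inMu (c : R.mu) :
    R.Induces (MulAut.conj (CycEnvelope.inMu R.augY R.chi c)) (ContinuousMulEquiv.refl R.PiY) := by
  intro x
  rw [MulAut.conj_apply, map_mul, map_mul, map_inv, R.proj_inMu, one_mul, inv_one, mul_one]
  rfl

variable (R) in
/-- **Kummer shifts induce the identity** on `Π^tp_Y` (Prop 2.14 (ii): "`α_δ` induces the identity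
on `Π^tp_Y`"). [cite: MochizukiEtTh2009, Prop 2.14(ii) p.49] -/
theorem induces_shift {δ : R.PiY → R.mu} (hδ : CycEnvelope.IsEnvCocycle R.augY R.chi δ) :
    R.Induces (CycEnvelope.shift hδ) (ContinuousMulEquiv.refl R.PiY) := fun x =>
  CycEnvelope.proj_shift hδ x

/-! ## §2. Existence of the induced automorphism (Prop 2.11 (ii) ⇒ Prop 2.14 (iii), first clause) -/

/-- For `α` mapping `μ_N` into `μ_N`, `proj (α x)` only depends on `proj x`:
`proj (α x) = proj (α (s^alg (proj x)))`. [cite: MochizukiEtTh2009, Prop 2.11(ii) p.44] -/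
theorem proj_apply_eq_of_inMu_into (α : MulAut R.env)
    (hμ : ∀ c : R.mu, CycEnvelope.proj R.augY R.chi (α (CycEnvelope.inMu R.augY R.chi c)) = 1)
    (x : R.env) :
    CycEnvelope.proj R.augY R.chi (α x) = CycEnvelope.proj R.augY R.chi
      (α (CycEnvelope.algSection R.augY R.chi (CycEnvelope.proj R.augY R.chi x))) := by
  conv_lhs => rw [← CycEnvelope.inMu_mul_algSection R.augY R.chi x]
  rw [map_mul, map_mul, hμ, one_mul]
  rfl

/-- "Into" is "onto" for the FINITE cyclotome: if `α` maps `μ_N` into `μ_N`, so does `α⁻¹`.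
[cite: MochizukiEtTh2009, Prop 2.11(ii) p.44] -/
theorem inMu_into_inv_of_inMu_into (α : MulAut R.env)
    (hμ : ∀ c : R.mu, CycEnvelope.proj R.augY R.chi (α (CycEnvelope.inMu R.augY R.chi c)) = 1)
    (c : R.mu) : CycEnvelope.proj R.augY R.chi (α⁻¹ (CycEnvelope.inMu R.augY R.chi c)) = 1 := by
  -- the restriction of `α` to `μ_N`, as a self-map of the finite set `μ_N`, is injective
  let φ : R.mu → R.mu := fun d => (α (CycEnvelope.inMu R.augY R.chi d)).left
  have hφ : ∀ d, CycEnvelope.inMu R.augY R.chi (φ d) = α (CycEnvelope.inMu R.augY R.chi d) :=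
    fun d => (eq_inMu_left_of_proj_eq_one (hμ d)).symm
  have hinj : Function.Injective φ := fun d d' h => by
    have h1 : α (CycEnvelope.inMu R.augY R.chi d) = α (CycEnvelope.inMu R.augY R.chi d') := by
      rw [← hφ, ← hφ, h]
    exact SemidirectProduct.inl_injective (α.injective h1)
  obtain ⟨d, hd⟩ := Finite.surjective_of_injective hinj c
  have h2 : α⁻¹ (CycEnvelope.inMu R.augY R.chi c) = CycEnvelope.inMu R.augY R.chi d := by
    rw [← hd, hφ, MulAut.inv_apply_self]
  rw [h2, R.proj_inMu]

/-- **Existence of the induced automorphism** (the mechanism of "every `α` induces one",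
Prop 2.11 (ii) / Prop 2.14 (iii)): a bi-continuous automorphism `α` of `Π^tp_Y[μ_N]` mapping the
cyclotome `μ_N` INTO itself induces a bi-continuous automorphism of `Π^tp_Y`, namely
`proj ∘ α ∘ s^alg`. [cite: MochizukiEtTh2009, Prop 2.14(iii) p.49] -/
theorem exists_induces_of_inMu_into (α : MulAut R.env) (hα : α ∈ contMulAut R.env)
    (hμ : ∀ c : R.mu, CycEnvelope.proj R.augY R.chi (α (CycEnvelope.inMu R.augY R.chi c)) = 1) :
    ∃ a : R.PiY ≃ₜ* R.PiY, R.Induces α a ∧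
      ∀ y, a y = CycEnvelope.proj R.augY R.chi (α (CycEnvelope.algSection R.augY R.chi y)) := by
  have hμ' := inMu_into_inv_of_inMu_into α hμ
  -- the two candidate homomorphisms `proj ∘ α^{±1} ∘ s^alg`
  let f : R.PiY →* R.PiY :=
    (CycEnvelope.proj R.augY R.chi).comp (α.toMonoidHom.comp (CycEnvelope.algSection R.augY R.chi))
  let g : R.PiY →* R.PiY := (CycEnvelope.proj R.augY R.chi).comp
    (α⁻¹.toMonoidHom.comp (CycEnvelope.algSection R.augY R.chi))
  have hf : ∀ x : R.env,
      CycEnvelope.proj R.augY R.chi (α x) = f (CycEnvelope.proj R.augY R.chi x) :=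
    fun x => proj_apply_eq_of_inMu_into α hμ x
  have hg : ∀ x : R.env,
      CycEnvelope.proj R.augY R.chi (α⁻¹ x) = g (CycEnvelope.proj R.augY R.chi x) :=
    fun x => proj_apply_eq_of_inMu_into α⁻¹ hμ' x
  have hgf : g.comp f = MonoidHom.id _ := MonoidHom.ext fun y => by
    change g (CycEnvelope.proj R.augY R.chi (α (CycEnvelope.algSection R.augY R.chi y))) = y
    rw [← hg, MulAut.inv_apply_self]
    rfl
  have hfg : f.comp g = MonoidHom.id _ := MonoidHom.ext fun y => by
    change f (CycEnvelope.proj R.augY R.chi (α⁻¹ (CycEnvelope.algSection R.augY R.chi y))) = y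
    rw [← hf, MulAut.apply_inv_self]
    rfl
  have hfc : Continuous f :=
    (CycEnvelope.continuous_proj R.augY R.chi).comp (hα.1.comp R.continuous_algSection)
  have hgc : Continuous g :=
    (CycEnvelope.continuous_proj R.augY R.chi).comp (hα.2.comp R.continuous_algSection)
  exact ⟨⟨MonoidHom.toMulEquiv f g hgf hfg, hfc, hgc⟩, fun x => hf x, fun y => rfl⟩

/-- **Existence, `Subgroup.map` form**: a bi-continuous automorphism `α` of `Π^tp_Y[μ_N]` with
`α(Ker(Π^tp_Y[μ_N] ↠ Π^tp_Y)) = Ker(Π^tp_Y[μ_N] ↠ Π^tp_Y)` induces a bi-continuous automorphism of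
`Π^tp_Y`. [cite: MochizukiEtTh2009, Prop 2.14(iii) p.49] -/
theorem exists_induces_of_map_ker (α : MulAut R.env) (hα : α ∈ contMulAut R.env)
    (hker : ((CycEnvelope.proj R.augY R.chi).ker).map α.toMonoidHom =
      (CycEnvelope.proj R.augY R.chi).ker) :
    ∃ a : R.PiY ≃ₜ* R.PiY, R.Induces α a := by
  obtain ⟨a, ha, -⟩ := exists_induces_of_inMu_into α hα fun c => by
    have h1 : CycEnvelope.inMu R.augY R.chi c ∈ (CycEnvelope.proj R.augY R.chi).ker :=
      (MonoidHom.mem_ker).mpr (R.proj_inMu c)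
    have h2 : α.toMonoidHom (CycEnvelope.inMu R.augY R.chi c) ∈
        ((CycEnvelope.proj R.augY R.chi).ker).map α.toMonoidHom := Subgroup.mem_map_of_mem _ h1
    rw [hker, MonoidHom.mem_ker] at h2
    exact h2
  exact ⟨a, ha⟩

/-- **Cor 2.18 (iii) ⇒ Prop 2.14 (iii), first clause**: if `Ker(Π• ↠ Π•_Y)` is the union of
the centralisers of the open subgroups (the named fact `RigidData.Cor218_iii_quotient`, FACT-LIST
F-0623 — a topological invariant), then EVERY automorphism of the topological group
`Π^tp_Y[μ_N]` induces an automorphism of the topological group `Π^tp_Y`.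
[cite: MochizukiEtTh2009, Cor 2.18(iii) p.61] -/
theorem exists_induces_of_cor218_iii_quotient (h : R.Cor218_iii_quotient) (α : MulAut R.env)
    (hα : α ∈ contMulAut R.env) : ∃ a : R.PiY ≃ₜ* R.PiY, R.Induces α a := by
  let e : R.env ≃ₜ* R.env := ⟨α, hα.1, hα.2⟩
  refine exists_induces_of_map_ker α hα ?_
  have hc : ((CycEnvelope.proj R.augY R.chi).ker).map e.toMulEquiv.toMonoidHom =
      (CycEnvelope.proj R.augY R.chi).ker := by
    have h' := h
    unfold Cor218_iii_quotient at h'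
    rw [← h']
    exact map_centralizerUnion_eq e
  exact hc

/-- … and the induced automorphism is unique. [cite: MochizukiEtTh2009, Cor 2.18(iii) p.61] -/
theorem existsUnique_induces_of_cor218_iii_quotient (h : R.Cor218_iii_quotient) (α : MulAut R.env)
    (hα : α ∈ contMulAut R.env) : ∃! a : R.PiY ≃ₜ* R.PiY, R.Induces α a := by
  obtain ⟨a, ha⟩ := exists_induces_of_cor218_iii_quotient h α hα
  exact ⟨a, ha, fun a' ha' => ha'.unique ha⟩

/-- **Every automorphism of a model mono-theta environment `M(η)` induces an automorphism of
`Π^tp_Y`**, given Cor 2.18 (iii) (F-0623). [cite: MochizukiEtTh2009, Prop 2.14(iii) p.49] -/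
theorem exists_induces_iso (h : R.Cor218_iii_quotient) {η : R.PiYdd → R.mu}
    {hη : η ∈ R.thetaCocycles} (α : (R.modelMono hη).Iso (R.modelMono hη)) :
    ∃ a : R.PiY ≃ₜ* R.PiY, R.Induces α.e.toMulEquiv a :=
  exists_induces_of_cor218_iii_quotient h α.e.toMulEquiv ⟨α.e.continuous, α.e.symm.continuous⟩

/-! ## §3. `MuConj` is an equivalence relation compatible with `Induces` (row F-0629) -/

/-- `MuConj` unfolded pointwise: `β = ι(c) · α(·) · ι(c)⁻¹`.
[cite: MochizukiEtTh2009, Cor 2.18(iv) p.61] -/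
theorem muConj_iff_exists_conj (α β : MulAut R.env) :
    R.MuConj α β ↔ ∃ c : R.mu, ∀ x, β x =
      CycEnvelope.inMu R.augY R.chi c * α x * (CycEnvelope.inMu R.augY R.chi c)⁻¹ := by
  refine exists_congr fun c => ⟨?_, fun h => MulEquiv.ext fun x => h x⟩
  rintro rfl x
  rfl

variable (R) in
/-- `MuConj` is reflexive. [cite: MochizukiEtTh2009, Cor 2.18(iv) p.61] -/
theorem muConj_refl (α : MulAut R.env) : R.MuConj α α :=
  ⟨1, by rw [map_one, map_one, one_mul]⟩

/-- `MuConj` is symmetric. [cite: MochizukiEtTh2009, Cor 2.18(iv) p.61] -/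
theorem MuConj.symm {α β : MulAut R.env} (h : R.MuConj α β) : R.MuConj β α := by
  obtain ⟨c, rfl⟩ := h
  exact ⟨c⁻¹, by rw [map_inv, map_inv, ← mul_assoc, inv_mul_cancel, one_mul]⟩

/-- `MuConj` is transitive. [cite: MochizukiEtTh2009, Cor 2.18(iv) p.61] -/
theorem MuConj.trans {α β γ : MulAut R.env} (h : R.MuConj α β) (h' : R.MuConj β γ) :
    R.MuConj α γ := by
  obtain ⟨c, rfl⟩ := h
  obtain ⟨d, rfl⟩ := h'
  exact ⟨d * c, by rw [map_mul, map_mul, mul_assoc]⟩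

variable (R) in
/-- **`MuConj` is an equivalence relation** on `Aut(Π^tp_Y[μ_N])`.
[cite: MochizukiEtTh2009, Cor 2.18(iv) p.61] -/
theorem muConj_equivalence : Equivalence R.MuConj :=
  ⟨R.muConj_refl, MuConj.symm, MuConj.trans⟩

/-- `MuConj` is a right congruence: `α ~ β ⇒ α ∘ γ ~ β ∘ γ`.
[cite: MochizukiEtTh2009, Cor 2.18(iv) p.61] -/
theorem MuConj.mul_right {α β : MulAut R.env} (h : R.MuConj α β) (γ : MulAut R.env) :
    R.MuConj (α * γ) (β * γ) := by
  obtain ⟨c, rfl⟩ := h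
  exact ⟨c, by rw [mul_assoc]⟩

/-- `γ ∘ conj(h) = conj(γ h) ∘ γ` in `Aut`. [cite: MochizukiEtTh2009, Def 2.13(i) p.47] -/
theorem mul_conj_eq_conj_mul (γ : MulAut R.env) (h : R.env) :
    γ * MulAut.conj h = MulAut.conj (γ h) * γ :=
  MulEquiv.ext fun x => by simp only [MulAut.mul_apply, MulAut.conj_apply, map_mul, map_inv]

/-- `MuConj` is a left congruence for automorphisms mapping the cyclotome into itself:
`α ~ β ⇒ γ ∘ α ~ γ ∘ β` whenever `γ(μ_N) ⊆ μ_N`. [cite: MochizukiEtTh2009, Cor 2.18(iv) p.61] -/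
theorem MuConj.mul_left {α β : MulAut R.env} (h : R.MuConj α β) (γ : MulAut R.env)
    (hγ : ∀ c : R.mu, ∃ c' : R.mu,
      γ (CycEnvelope.inMu R.augY R.chi c) = CycEnvelope.inMu R.augY R.chi c') :
    R.MuConj (γ * α) (γ * β) := by
  obtain ⟨c, rfl⟩ := h
  obtain ⟨c', hc'⟩ := hγ c
  exact ⟨c', by rw [← mul_assoc, mul_conj_eq_conj_mul, hc', mul_assoc]⟩

/-- `MuConj` is a left congruence for INDUCING automorphisms.
[cite: MochizukiEtTh2009, Cor 2.18(iv) p.61] -/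
theorem MuConj.mul_left_of_induces {α β : MulAut R.env} (h : R.MuConj α β) {γ : MulAut R.env}
    {g : R.PiY ≃ₜ* R.PiY} (hγ : R.Induces γ g) : R.MuConj (γ * α) (γ * β) :=
  h.mul_left γ hγ.exists_inMu_eq

/-- **`μ_N`-conjugate automorphisms induce the same automorphism of `Π^tp_Y`.**
[cite: MochizukiEtTh2009, Cor 2.18(iv) p.61] -/
theorem MuConj.induces_iff {α β : MulAut R.env} (h : R.MuConj α β) (a : R.PiY ≃ₜ* R.PiY) :
    R.Induces α a ↔ R.Induces β a := by
  obtain ⟨c, rfl⟩ := h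
  have key : ∀ x, CycEnvelope.proj R.augY R.chi
      ((MulAut.conj (CycEnvelope.inMu R.augY R.chi c) * α) x) =
      CycEnvelope.proj R.augY R.chi (α x) := fun x => by
    rw [MulAut.mul_apply, MulAut.conj_apply, map_mul, map_mul, map_inv, R.proj_inMu, one_mul,
      inv_one, mul_one]
  exact ⟨fun hα x => by rw [key, hα], fun hβ x => by rw [← key, hβ]⟩

/-- **`μ_N`-conjugate bi-continuous automorphisms have the same image in `Out(Π^tp_Y[μ_N])`**
(`μ_N`-conjugation is inner): the superscript `μ` of Cor 2.18 (iv) is invisible in `D_Y ⊆ Out`.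
[cite: MochizukiEtTh2009, Cor 2.18(iv) p.61] -/
theorem MuConj.topOut_mk_eq {α β : MulAut R.env} (h : R.MuConj α β) (hα : α ∈ contMulAut R.env)
    (hβ : β ∈ contMulAut R.env) : TopOut.mk R.env ⟨β, hβ⟩ = TopOut.mk R.env ⟨α, hα⟩ := by
  obtain ⟨c, hc⟩ := h
  have hcont := R.toThetaEnvData.conj_inMu_mem_contMulAut c
  have hprod : (⟨β, hβ⟩ : contMulAut R.env) =
      ⟨MulAut.conj (CycEnvelope.inMu R.augY R.chi c), hcont⟩ * ⟨α, hα⟩ := Subtype.ext hc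
  have hone : TopOut.mk R.env ⟨MulAut.conj (CycEnvelope.inMu R.augY R.chi c), hcont⟩ = 1 :=
    (QuotientGroup.eq_one_iff _).mpr (Subgroup.mem_subgroupOf.mpr ⟨_, rfl⟩)
  rw [hprod, map_mul, hone, one_mul]

/-! ## §4. Transfer of invariant subgroups along `Induces` (reading of row F-0627, clauses 2–3) -/

/-- **Transfer**: if `α` induces `a`, then `α` carries the inverse image of `H ⊆ Π^tp_Y` onto the
inverse image of `a(H)`. [cite: MochizukiEtTh2009, Cor 2.19(i) p.64] -/
theorem Induces.map_comap_proj {α : MulAut R.env} {a : R.PiY ≃ₜ* R.PiY} (hα : R.Induces α a)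
    (H : Subgroup R.PiY) :
    (H.comap (CycEnvelope.proj R.augY R.chi)).map α.toMonoidHom =
      (H.map a.toMulEquiv.toMonoidHom).comap (CycEnvelope.proj R.augY R.chi) := by
  ext x
  constructor
  · rintro ⟨y, hy, rfl⟩
    have hy' : CycEnvelope.proj R.augY R.chi y ∈ H := hy
    change CycEnvelope.proj R.augY R.chi (α y) ∈ H.map a.toMulEquiv.toMonoidHom
    rw [hα y]
    exact Subgroup.mem_map_of_mem _ hy'
  · intro hx
    obtain ⟨p, hp, hpx⟩ := Subgroup.mem_map.mp (Subgroup.mem_comap.mp hx)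
    refine ⟨α⁻¹ x, ?_, MulAut.apply_inv_self _ α x⟩
    change CycEnvelope.proj R.augY R.chi (α⁻¹ x) ∈ H
    have hp' : a.symm (CycEnvelope.proj R.augY R.chi x) = p := by
      rw [ContinuousMulEquiv.symm_apply_eq]
      exact hpx.symm
    rw [hα.inv x, hp']
    exact hp

/-- **Transfer, invariance form**: for an inducing pair `(α, a)` and `H ⊆ Π^tp_Y`, `α` preserves the
inverse image `H · μ_N` of `H` iff `a` preserves `H`. [cite: MochizukiEtTh2009, Cor 2.19(i) p.64] -/
theorem Induces.map_comap_proj_eq_iff {α : MulAut R.env} {a : R.PiY ≃ₜ* R.PiY} (hα : R.Induces α a)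
    (H : Subgroup R.PiY) :
    (H.comap (CycEnvelope.proj R.augY R.chi)).map α.toMonoidHom =
        H.comap (CycEnvelope.proj R.augY R.chi) ↔
      H.map a.toMulEquiv.toMonoidHom = H := by
  rw [hα.map_comap_proj]
  exact (Subgroup.comap_injective (CycEnvelope.proj_surjective R.augY R.chi)).eq_iff

/-- **Clause 3 of `Cor219_i_subquotients` along `Induces`**: `α` preserves `Δ^tp_Y[μ_N]` iff the
induced `a` preserves `Δ^tp_Y = Ker(Π^tp_Y ↠ G_K)`. [cite: MochizukiEtTh2009, Cor 2.19(i) p.64] -/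
theorem Induces.map_deltaEnv_eq_iff {α : MulAut R.env} {a : R.PiY ≃ₜ* R.PiY} (hα : R.Induces α a) :
    (CycEnvelope.deltaEnv R.augY R.chi).map α.toMonoidHom = CycEnvelope.deltaEnv R.augY R.chi ↔
      R.augY.ker.map a.toMulEquiv.toMonoidHom = R.augY.ker := by
  have : CycEnvelope.deltaEnv R.augY R.chi = R.augY.ker.comap (CycEnvelope.proj R.augY R.chi) :=
    (MonoidHom.comap_ker _ _).symm
  rw [this]
  exact hα.map_comap_proj_eq_iff _

/-- **Clause 2 of `Cor219_i_subquotients` along `Induces`** (take `H := l·Δ_Θ`,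
`hH := R.lDeltaTheta_le.trans inf_le_left`), for any `H ⊆ Π^tp_Ÿ`: `α` preserves
`μ_N · s^alg(H)` iff the induced `a` preserves `H` (viewed in `Π^tp_Y`).
[cite: MochizukiEtTh2009, Cor 2.19(i) p.64] -/
theorem Induces.map_algImage_sup_ker_eq_iff {α : MulAut R.env} {a : R.PiY ≃ₜ* R.PiY}
    (hα : R.Induces α a) (H : Subgroup R.PiX) (hH : H ≤ R.PiYdd) :
    (R.algImage H ⊔ (CycEnvelope.proj R.augY R.chi).ker).map α.toMonoidHom =
        R.algImage H ⊔ (CycEnvelope.proj R.augY R.chi).ker ↔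
      (H.comap R.PiY.subtype).map a.toMulEquiv.toMonoidHom = H.comap R.PiY.subtype := by
  rw [R.algImage_sup_ker_eq H hH]
  exact hα.map_comap_proj_eq_iff _

end RigidData
end Literature.AnabelianGeometry.EtaleTheta
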